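import Summits.RiemannHypothesis.RiemannHypothesis.Theorems.WeilWindowFlowWindowLipschitzStubCommutatorBoundAux4
import Summits.RiemannHypothesis.RiemannHypothesis.Theorems.WeilWindowFlowWindowLipschitzStubSupBoundAux

/-!
# Stub `stub_commutatorBound` (E) for crux `WeilWindowFlow.WindowLipschitz`
(item stmt-RiemannHypothesis-1039; registered in BOTH line skeletons `cut-dont-squeeze` (rev 4) and
`borderline-barrier` (rev 2), `Summits/RiemannHypothesis/RiemannHypothesis/Cruxes/WindowLipschitz/Lines/`)

**What is proved.** From the uniform sup bound (A) and the `L²` edge-mass law (B) of ground states on a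
compact window range `[b₀, A]`: for every window `a ∈ [b₀, A]`, width `0 < h ≤ h₀`, ground state `u` and
admissible cutoff `χ` (values in `[0,1]`, `= 1` on `|x| ≤ a − 2h`, `= 0` on `|x| ≥ a − h`, slope `≤ 1/h`),
the right-hand side of the localised cut inequality (archimedean + prime commutators + polar remainder)
is `≤ C h` and `∫‖χu‖² ≥ 1/2`.

**Proof.** The analytic content is the LANDED core `stub_commutatorBound_core` (Toolkits I–IV) for a
NORMALISED ground state (measurable, pointwise zero off the window, pointwise bounded). This file only
normalises: replace `u` by the a.e.-equal `ũ = 1_S · u*` (`u*` a measurable representative,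
`S = {‖u*‖ ≤ K_A} ∩ [−a, a]`), transport (A), (B) and the six integrals of the conclusion along the a.e.
equality (translation invariance of null sets for the shifted factors), and choose
`h₀ = min(d₀'/16, 1/(16(K_B+1)))`, `d₀' = min(d₀, 1/4)`.

Sources: line card `Lines/cut-dont-squeeze.md` §Stub E; Cycon–Froese–Kirsch–Simon, *Schrödinger
Operators*, Thm 3.2 (IMS localisation).
-/

set_option linter.dupNamespace false

noncomputable section

open MeasureTheory Set Filter
open scoped Topology ENNReal NNReal

namespace Summit.RiemannHypothesis.RiemannHypothesis.Theorems.WeilWindowFlowWindowLipschitz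

open Literature.NumberTheory.LFunctions

/-- **Normalisation of a ground state.** A ground state `u` of the window `a` with `‖u‖ ≤ K` a.e. has an
a.e.-equal MEASURABLE modification `ũ` vanishing pointwise off `[−a, a]` and bounded pointwise by
`max K 0`. [folklore] -/
theorem stub_commutatorBound_normalise {a K : ℝ} {u : ℝ → ℂ} (hu : IsWeilGroundState a u)
    (hK : ∀ᵐ x : ℝ, ‖u x‖ ≤ K) :
    ∃ v : ℝ → ℂ, Measurable v ∧ v =ᵐ[volume] u ∧ (∀ x, x ∉ Icc (-a) a → v x = 0) ∧
      ∀ x, ‖v x‖ ≤ max K 0 := by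
  set u₁ : ℝ → ℂ := hu.memLp.1.mk u with hu₁
  have hu₁m : Measurable u₁ := hu.memLp.1.stronglyMeasurable_mk.measurable
  have hu₁ae : u =ᵐ[volume] u₁ := hu.memLp.1.ae_eq_mk
  set S : Set ℝ := {x | ‖u₁ x‖ ≤ max K 0} ∩ Icc (-a) a with hS
  have hSm : MeasurableSet S :=
    (measurableSet_le hu₁m.norm measurable_const).inter measurableSet_Icc
  refine ⟨S.indicator u₁, hu₁m.indicator hSm, ?_, ?_, ?_⟩
  · filter_upwards [hu₁ae, hK, hu.ae_eq_zero_of_notMem] with x hx hxK hx0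
    by_cases hxI : x ∈ Icc (-a) a
    · have hxS : x ∈ S := ⟨by show ‖u₁ x‖ ≤ max K 0; rw [← hx]; exact hxK.trans (le_max_left _ _), hxI⟩
      rw [indicator_of_mem hxS, hx]
    · have hxS : x ∉ S := fun h ↦ hxI h.2
      rw [indicator_of_notMem hxS, hx0 hxI]
  · intro x hx
    exact indicator_of_notMem (fun h ↦ hx h.2) _
  · intro x
    by_cases hxS : x ∈ S
    · rw [indicator_of_mem hxS]
      exact hxS.1
    · rw [indicator_of_notMem hxS, norm_zero]
      exact le_max_right _ _

/-- **Stub E `stub_commutatorBound` — the commutator bound** (verbatim registered statement of lines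
`cut-dont-squeeze` (E) and `borderline-barrier` (S4)). See the module docstring. -/
theorem stub_commutatorBound :
    (∀ b₀ A : ℝ, 0 < b₀ → b₀ ≤ A → ∃ K : ℝ, ∀ (a : ℝ) (u : ℝ → ℂ), b₀ ≤ a → a ≤ A →
      IsWeilGroundState a u → ∀ᵐ x : ℝ, ‖u x‖ ≤ K) →
    (∀ b₀ A : ℝ, 0 < b₀ → b₀ ≤ A → ∃ K d₀ : ℝ, 0 < d₀ ∧ d₀ < 1 ∧
      ∀ (a r : ℝ) (u : ℝ → ℂ), b₀ ≤ a → a ≤ A → IsWeilGroundState a u → 0 < r → r ≤ d₀ →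
        ∫ x in {x : ℝ | a - r < |x|}, ‖u x‖ ^ 2 ≤ K * r / Real.log (1 / r)) →
    ∀ b₀ A : ℝ, 0 < b₀ → b₀ ≤ A → ∃ C h₀ : ℝ, 0 < h₀ ∧
        ∀ (a h : ℝ) (u : ℝ → ℂ) (χ : ℝ → ℝ), b₀ ≤ a → a ≤ A → 0 < h → h ≤ h₀ →
        IsWeilGroundState a u → (∀ x y, |χ x - χ y| ≤ |x - y| / h) → (∀ x, 0 ≤ χ x ∧ χ x ≤ 1) →
        (∀ x, |x| ≤ a - 2 * h → χ x = 1) → (∀ x, a - h ≤ |x| → χ x = 0) →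
        (∫ t in Ioi (0 : ℝ), weilArchDensity t *
              ∫ x, (χ (x + t) - χ x) ^ 2 * (‖u (x + t)‖ * ‖u x‖)) +
          (∑ n ∈ weilPrimeIndex a, (ArithmeticFunction.vonMangoldt n : ℝ) / Real.sqrt n *
              ∫ x, (χ (x + Real.log n) - χ x) ^ 2 * (‖u (x + Real.log n)‖ * ‖u x‖)) +
          2 * ‖∫ t, ((1 - χ t : ℝ) : ℂ) * u t * (Real.cosh (t / 2) : ℂ)‖ ^ 2 +
          2 * ‖∫ t, u t * (Real.cosh (t / 2) : ℂ)‖ *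
              ‖∫ t, (((1 - χ t) ^ 2 : ℝ) : ℂ) * u t * (Real.cosh (t / 2) : ℂ)‖ +
          2 * ‖∫ t, u t * (Real.sinh (t / 2) : ℂ)‖ *
              ‖∫ t, (((1 - χ t) ^ 2 : ℝ) : ℂ) * u t * (Real.sinh (t / 2) : ℂ)‖ ≤ C * h ∧
          1 / 2 ≤ ∫ x, ‖(χ x : ℂ) * u x‖ ^ 2 := by
  intro hA hB b₀ A hb₀ hbA
  obtain ⟨KA, hKA⟩ := hA b₀ A hb₀ hbA
  obtain ⟨KB, d₀, hd₀, hd₀1, hKB⟩ := hB b₀ A hb₀ hbA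
  set KA' : ℝ := max KA 0 with hKA'
  set KB' : ℝ := max KB 0 with hKB'
  set d₁ : ℝ := min d₀ (1 / 4) with hd₁
  set SA : ℝ := ∑ n ∈ weilPrimeIndex A, (ArithmeticFunction.vonMangoldt n : ℝ) / Real.sqrt n
    with hSAdef
  have hKB'0 : 0 ≤ KB' := le_max_right _ _
  have hd₁0 : 0 < d₁ := lt_min hd₀ (by norm_num)
  have hd₁4 : d₁ ≤ 1 / 4 := min_le_right _ _
  have hd₁d₀ : d₁ ≤ d₀ := min_le_left _ _
  set C : ℝ := 96 * KB' + 4 * (9 * (1 + KB') + weilArchDensity (d₁ / 8) * (A + 1 / 2)) * (1 + KB') +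
      4 * SA * KA' * (1 + KB') + 2 * (2 * Real.cosh (A / 2) * (1 + KB')) ^ 2 +
      4 * (Real.cosh (A / 2) * (A + 1 / 2)) * (2 * Real.cosh (A / 2) * (1 + KB')) with hCdef
  set h₀ : ℝ := min (d₁ / 16) (1 / (16 * (KB' + 1))) with hh₀
  have hh₀pos : 0 < h₀ := lt_min (by positivity) (by positivity)
  refine ⟨C, h₀, hh₀pos, ?_⟩
  intro a h u χ hba haA hh hhh₀ hu hχlip hχ01 hχ1 _hχ0
  have hhd : 16 * h ≤ d₁ := by
    have : h ≤ d₁ / 16 := hhh₀.trans (min_le_left _ _)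
    linarith
  have hhK : 16 * (KB' + 1) * h ≤ 1 := by
    have h1 : h ≤ 1 / (16 * (KB' + 1)) := hhh₀.trans (min_le_right _ _)
    rw [le_div_iff₀ (by positivity)] at h1
    linarith
  -- normalise `u`
  obtain ⟨v, hvm, hvu, hv0, hvb⟩ := stub_commutatorBound_normalise hu (hKA a u hba haA hu)
  have hgs : IsWeilGroundState a v := hu.congr_ae hvu.symm
  -- the edge-mass law for `v` with constant `KB'` on `(0, d₁]`
  have hBv : ∀ r, 0 < r → r ≤ d₁ →
      ∫ x in {x | a - r < |x|}, ‖v x‖ ^ 2 ≤ KB' * r / Real.log (1 / r) := by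
    intro r hr hrd
    have hrd₀ : r ≤ d₀ := hrd.trans hd₁d₀
    have heq : ∫ x in {x | a - r < |x|}, ‖v x‖ ^ 2 = ∫ x in {x | a - r < |x|}, ‖u x‖ ^ 2 :=
      integral_congr_ae (ae_restrict_of_ae (hvu.mono fun x hx ↦ by simp only [hx]))
    rw [heq]
    have hlog : 0 < Real.log (1 / r) := Real.log_pos (by
      rw [lt_div_iff₀ hr]; linarith [hrd₀.trans_lt hd₀1])
    calc _ ≤ KB * r / Real.log (1 / r) := hKB a r u hba haA hu hr hrd₀
      _ ≤ KB' * r / Real.log (1 / r) :=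
          div_le_div_of_nonneg_right (mul_le_mul_of_nonneg_right (le_max_left _ _) hr.le) hlog.le
  have hSA : ∑ n ∈ weilPrimeIndex a, (ArithmeticFunction.vonMangoldt n : ℝ) / Real.sqrt n ≤ SA :=
    Finset.sum_le_sum_of_subset_of_nonneg (stub_supBound_weilPrimeIndex_mono haA)
      (fun n _ _ ↦ div_nonneg ArithmeticFunction.vonMangoldt_nonneg (Real.sqrt_nonneg _))
  have hcore := stub_commutatorBound_core hvm hgs hv0 hvb hKB'0 hd₁0 hd₁4 hBv haA hSA hh hhd hhK
    hχlip hχ01 hχ1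
  -- transport the six integrals from `v` back to `u`
  have hsh : ∀ s : ℝ, (fun x ↦ v (x + s)) =ᵐ[volume] fun x ↦ u (x + s) := fun s ↦
    (measurePreserving_add_right volume s).quasiMeasurePreserving.ae_eq_comp hvu
  have e1 : ∀ s : ℝ, ∫ x, (χ (x + s) - χ x) ^ 2 * (‖v (x + s)‖ * ‖v x‖) =
      ∫ x, (χ (x + s) - χ x) ^ 2 * (‖u (x + s)‖ * ‖u x‖) := by
    intro s
    refine integral_congr_ae ?_
    filter_upwards [hvu, hsh s] with x hx hxs
    simp only [hx, hxs]
  have e3 : ∀ w : ℝ → ℂ, ∫ t, w t * v t * (Real.cosh (t / 2) : ℂ) =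
      ∫ t, w t * u t * (Real.cosh (t / 2) : ℂ) := fun w ↦
    integral_congr_ae (hvu.mono fun x hx ↦ by simp only [hx])
  have e4 : ∀ w : ℝ → ℂ, ∫ t, w t * v t * (Real.sinh (t / 2) : ℂ) =
      ∫ t, w t * u t * (Real.sinh (t / 2) : ℂ) := fun w ↦
    integral_congr_ae (hvu.mono fun x hx ↦ by simp only [hx])
  have e5 : ∫ t, v t * (Real.cosh (t / 2) : ℂ) = ∫ t, u t * (Real.cosh (t / 2) : ℂ) :=
    integral_congr_ae (hvu.mono fun x hx ↦ by simp only [hx])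
  have e6 : ∫ t, v t * (Real.sinh (t / 2) : ℂ) = ∫ t, u t * (Real.sinh (t / 2) : ℂ) :=
    integral_congr_ae (hvu.mono fun x hx ↦ by simp only [hx])
  have e7 : ∫ x, ‖(χ x : ℂ) * v x‖ ^ 2 = ∫ x, ‖(χ x : ℂ) * u x‖ ^ 2 :=
    integral_congr_ae (hvu.mono fun x hx ↦ by simp only [hx])
  simp only [e1, e3, e4, e5, e6, e7] at hcore
  exact hcore

end Summit.RiemannHypothesis.RiemannHypothesis.Theorems.WeilWindowFlowWindowLipschitz

end
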